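import Mathlib
import HarnessLib
import Summits.Ventures.LatticeQCDFlow.Scaling.EntropyLagLaw
import Summits.Ventures.LatticeQCDFlow.Scaling.JarzynskiSampleSize
import Summits.Ventures.LatticeQCDFlow.Scaling.SweepAllocationLaw

/-!
# EntropyLagLawDoeblin — entropy contraction of a relaxation layer from a DOEBLIN MINORISATION
# (`P(x, ·) ≥ ε·π` ⇒ `KL(μP‖π) ≤ (1 − ε)·KL(μ‖π)`), from laziness (`κ = 1 − ε`), the Hoeffding
# envelope of the equilibrium log-MGF, and the packaged lag law
# `|⟨W⟩ − ΔF − KL_qs| ≤ KL_qs + (nδ)²·ΔD²·(1 − ε)/(2n·ε)` — no sup-norm factor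

HONEST FRAMING: exact (Metropolis-corrected) sampling algorithms for lattice gauge theory;
figures of merit are autocorrelation/cost numbers at stated couplings and volumes; no
continuum-physics claim.

Venture `LatticeQCDFlow` (cell pub-lqcd), topic `Scaling`; FANOUT row 19 (`su2-snf`, GEN-9).  OUR
WORK (finite sums); USED: Mathlib's Hoeffding lemma (`ProbabilityTheory.hasSubgaussianMGF_of_mem_Icc`);
the KL data-processing step is the finite Jensen argument (Polyanskiy–Wu Thm 7.4, NAMED ONLY; the
Literature's `FiniteDataProcessing` states it for general `f`-divergences).  `Scaling/EntropyLagLaw` proves the lag law from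
an ENTROPY-CONTRACTION coefficient `κ` of each layer towards its target; this file discharges `κ`:

* §1 `klFin_convexComb_le` — convexity of `KL(· ‖ π)` (two-point, from `Real.convexOn_mul_log`);
* §2 **`klFin_stepLaw_le`** — data processing: `KL(μR ‖ π) ≤ KL(μ ‖ π)` for a row-stochastic
  `π`-stationary `R` (Jensen for `t log t` with the backward weights);
* §3 **`klFin_stepLaw_le_of_doeblin`** — `P` row-stochastic, `π`-stationary, `P(x, y) ≥ ε·π(y)`
  (`0 < ε ≤ 1`) ⇒ `KL(μP ‖ π) ≤ (1 − ε)·KL(μ ‖ π)` (split `P = ε·Π + (1 − ε)·R`, convexity, DPI for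
  the residual kernel `R`); `klFin_stepLaw_lazyLayer_le` (row 8's lazy layers: `κ = 1 − ε`, by
  convexity alone); `klFin_stepLaw_perfect` (`κ = 1`);
* §4 **`log_sum_gibbs_exp_le_hoeffding`** — `|D x − D y| ≤ ΔD` ⇒
  `log Σ_y π(y) e^{t(D y − ⟨D⟩_π)} ≤ t²ΔD²/8` for every Gibbs law of the family and every real `t`;
* §5 **`abs_layerDissipation_sub_qs_le_doeblin`** — THE PACKAGED LAW: row-stochastic layers, each
  stationary for and Doeblin-minorised by its target (`P_k(x, ·) ≥ ε·π_{k+1}`, `0 < ε < 1`), uniform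
  grid `c_{k+1} − c_k = δ > 0`, `|D x − D y| ≤ ΔD`:
  `|⟨W⟩ − ΔF − KL_qs| ≤ KL_qs + n·δ²·ΔD²·(1−ε)/(2ε)` — unit span `nδ = 1`: lag term
  `ΔD²(1−ε)/(2nε)`, POLYNOMIAL in `ΔD/n`, where the `χ²` route carries `e^{ΔD/(2n)}`;
  `…_subGaussian` — with a measured envelope `Λ ≤ λ²s²/2`: `KL_qs + 2nδ²s²(1−ε)/ε`, i.e.
  `(2τ − 1)·s²/n` per unit span with `2τ = (2−ε)/ε` (E7's `2τ_int σ²/n_step` shape);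
* §6 `iterate_stepLaw_prob`, `klFin_iterate_stepLaw_le_of_doeblin` (`m` sweeps: `κ_m = 1 − (1−ε)^m`) and
  **`entropyEnvelope_budget_eq_sweepFactor`** — at a fixed sweep budget the sub-Gaussian envelope is
  `(σ²/T)·sweepFactor q m`, `Scaling/SweepAllocationLaw`'s non-decreasing factor: one sweep per step.

NOT CLAIMED: a Doeblin constant for any lattice heat-bath / over-relaxation sweep; the sub-Gaussian
sharpening `Λ ≤ λ²σ̄²/2` (an equilibrium property of `D` to be MEASURED, not assumed here).
-/

namespace Summit.Ventures.LatticeQCDFlow.Scaling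

open Finset
open Literature.Probability.MarkovChains (IsRowStochastic stepLaw stepLaw_nonneg sum_stepLaw)
open Summit.Ventures.LatticeQCDFlow.Exactness
open Summit.Ventures.LatticeQCDFlow.Theory2

variable {X : Type*} [Fintype X]

/-! ## §1 Convexity of `KL(· ‖ π)` -/

/-- Pointwise convexity: `φ(s) = s·log(s/p)` is convex on `s ≥ 0` (`p > 0`). -/
theorem mul_log_div_convexComb_le {p a b t : ℝ} (hp : 0 < p) (ha : 0 ≤ a) (hb : 0 ≤ b)
    (ht0 : 0 ≤ t) (ht1 : t ≤ 1) :
    (t * a + (1 - t) * b) * Real.log ((t * a + (1 - t) * b) / p)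
      ≤ t * (a * Real.log (a / p)) + (1 - t) * (b * Real.log (b / p)) := by
  -- reduce to `x log x` via `s log (s/p) = s log s − s log p`
  have hsplit : ∀ s : ℝ, 0 ≤ s → s * Real.log (s / p) = s * Real.log s - s * Real.log p := by
    intro s hs
    rcases eq_or_lt_of_le hs with h | h
    · rw [← h]; simp
    · rw [Real.log_div h.ne' hp.ne']; ring
  have hm : 0 ≤ t * a + (1 - t) * b := by nlinarith
  rw [hsplit _ hm, hsplit _ ha, hsplit _ hb]
  have hconv := Real.convexOn_mul_log
  have key := hconv.2 (Set.mem_Ici.2 ha) (Set.mem_Ici.2 hb) ht0 (by linarith : 0 ≤ 1 - t)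
    (by ring : t + (1 - t) = 1)
  simp only [smul_eq_mul] at key
  nlinarith [key]

/-- **`KL(t·μ + (1−t)·μ' ‖ π) ≤ t·KL(μ ‖ π) + (1−t)·KL(μ' ‖ π)`** for `μ, μ' ≥ 0`, `π > 0`,
`t ∈ [0, 1]`. [ours] -/
theorem klFin_convexComb_le {μ μ' π : X → ℝ} (hμ : ∀ x, 0 ≤ μ x) (hμ' : ∀ x, 0 ≤ μ' x)
    (hπ : ∀ x, 0 < π x) {t : ℝ} (ht0 : 0 ≤ t) (ht1 : t ≤ 1) :
    klFin (fun x => t * μ x + (1 - t) * μ' x) π ≤ t * klFin μ π + (1 - t) * klFin μ' π := by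
  unfold klFin
  rw [mul_sum, mul_sum, ← sum_add_distrib]
  exact sum_le_sum fun x _ => mul_log_div_convexComb_le (hπ x) (hμ x) (hμ' x) ht0 ht1

/-! ## §2 Data processing for `KL` under a stationary row-stochastic kernel -/

/-- **DATA PROCESSING: `KL(μR ‖ π) ≤ KL(μ ‖ π)`** for a row-stochastic `R` with `πR = π`, `π > 0`,
`μ ≥ 0` — Jensen for `t ↦ t log t` with the backward weights `π(x)R(x,y)/π(y)` (the finite
data-processing inequality, Polyanskiy–Wu Thm 7.4, in the special case needed here). [folklore] -/
theorem klFin_stepLaw_le {R : X → X → ℝ} (hR : IsRowStochastic R) {π μ : X → ℝ}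
    (hπ : ∀ x, 0 < π x) (hst : ∀ y, ∑ x, π x * R x y = π y) (hμ : ∀ x, 0 ≤ μ x) :
    klFin (stepLaw R μ) π ≤ klFin μ π := by
  have hconv := Real.convexOn_mul_log
  -- per output state `y`: Jensen with weights `w x = π x R x y / π y` at points `μ x / π x`
  have hy : ∀ y, stepLaw R μ y * Real.log (stepLaw R μ y / π y)
      ≤ ∑ x, π x * R x y * (μ x / π x * Real.log (μ x / π x)) := by
    intro y
    have hπy := hπ y
    set w : X → ℝ := fun x => π x * R x y / π y with hw
    have hw0 : ∀ x ∈ (univ : Finset X), 0 ≤ w x := fun x _ =>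
      div_nonneg (mul_nonneg (hπ x).le (hR.1 x y)) hπy.le
    have hw1 : ∑ x ∈ univ, w x = 1 := by
      simp only [hw]; rw [← sum_div, hst y, div_self hπy.ne']
    have hmem : ∀ x ∈ (univ : Finset X), μ x / π x ∈ Set.Ici (0:ℝ) := fun x _ =>
      Set.mem_Ici.2 (div_nonneg (hμ x) (hπ x).le)
    have hJ := hconv.map_sum_le hw0 hw1 hmem
    -- the barycentre is `(μR)(y)/π(y)`
    have hbar : ∑ x ∈ univ, w x • (μ x / π x) = stepLaw R μ y / π y := by
      simp only [hw, smul_eq_mul]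
      unfold stepLaw
      rw [sum_div]
      refine sum_congr rfl fun x _ => ?_
      field_simp [(hπ x).ne']
    rw [hbar] at hJ
    simp only [smul_eq_mul] at hJ
    -- multiply by `π y > 0`
    have := mul_le_mul_of_nonneg_left hJ hπy.le
    have hlhs : π y * (stepLaw R μ y / π y * Real.log (stepLaw R μ y / π y))
        = stepLaw R μ y * Real.log (stepLaw R μ y / π y) := by
      field_simp
    have hrhs : π y * ∑ x ∈ univ, w x * (μ x / π x * Real.log (μ x / π x))
        = ∑ x, π x * R x y * (μ x / π x * Real.log (μ x / π x)) := by
      rw [mul_sum]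
      refine sum_congr rfl fun x _ => ?_
      simp only [hw]
      field_simp
    rw [hlhs, hrhs] at this
    exact this
  unfold klFin
  calc ∑ y, stepLaw R μ y * Real.log (stepLaw R μ y / π y)
      ≤ ∑ y, ∑ x, π x * R x y * (μ x / π x * Real.log (μ x / π x)) := sum_le_sum fun y _ => hy y
    _ = ∑ x, (∑ y, R x y) * (π x * (μ x / π x * Real.log (μ x / π x))) := by
        rw [sum_comm]
        refine sum_congr rfl fun x _ => ?_
        rw [sum_mul]
        exact sum_congr rfl fun y _ => by ring
    _ = ∑ x, μ x * Real.log (μ x / π x) := by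
        refine sum_congr rfl fun x _ => ?_
        rw [hR.2 x, one_mul]
        field_simp [(hπ x).ne']

/-! ## §3 Entropy contraction: Doeblin, lazy, perfect -/

/-- **DOEBLIN ⇒ ENTROPY CONTRACTION.**  `P` row-stochastic and `π`-stationary (`π > 0` a probability
law) with `P(x, y) ≥ ε·π(y)` for all `x, y`, `0 < ε ≤ 1`: for every probability law `μ ≥ 0`,
`KL(μP ‖ π) ≤ (1 − ε)·KL(μ ‖ π)`. [ours] -/
theorem klFin_stepLaw_le_of_doeblin {P : X → X → ℝ} (hP : IsRowStochastic P) {π : X → ℝ}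
    (hπ : ∀ x, 0 < π x) (hπ1 : ∑ x, π x = 1) (hst : ∀ y, ∑ x, π x * P x y = π y)
    {ε : ℝ} (hε0 : 0 < ε) (hε1 : ε ≤ 1) (hmin : ∀ x y, ε * π y ≤ P x y)
    {μ : X → ℝ} (hμ : ∀ x, 0 ≤ μ x) (hμ1 : ∑ x, μ x = 1) :
    klFin (stepLaw P μ) π ≤ (1 - ε) * klFin μ π := by
  rcases eq_or_lt_of_le hε1 with h1 | h1
  · -- `ε = 1`: `P(x, ·) = π`, so `μP = π` and `KL(π‖π) = 0`
    subst h1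
    have hPeq : ∀ x y, P x y = π y := by
      intro x
      have hle : ∀ y, π y ≤ P x y := fun y => by simpa using hmin x y
      have hsum0 : ∑ y, (P x y - π y) = 0 := by rw [sum_sub_distrib, hP.2 x, hπ1, sub_self]
      have hzero := (sum_eq_zero_iff_of_nonneg (fun y _ => sub_nonneg.2 (hle y))).1 hsum0
      intro y
      have := hzero y (mem_univ y)
      linarith
    have hstep : stepLaw P μ = π := by
      funext y
      unfold stepLaw
      simp_rw [hPeq]
      rw [← sum_mul, hμ1, one_mul]
    rw [hstep, klFin_self hπ, sub_self, zero_mul]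
  · -- `ε < 1`: residual kernel `R = (P − εΠ)/(1 − ε)`
    have h1e : 0 < 1 - ε := sub_pos.2 h1
    set R : X → X → ℝ := fun x y => (P x y - ε * π y) / (1 - ε) with hR
    have hRrs : IsRowStochastic R := by
      refine ⟨fun x y => div_nonneg (sub_nonneg.2 (hmin x y)) h1e.le, fun x => ?_⟩
      simp only [hR]
      rw [← sum_div, sum_sub_distrib, hP.2 x, ← mul_sum, hπ1, mul_one, div_self h1e.ne']
    have hRst : ∀ y, ∑ x, π x * R x y = π y := by
      intro y
      simp only [hR]
      have : ∑ x, π x * ((P x y - ε * π y) / (1 - ε))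
          = (∑ x, π x * P x y - ε * π y * ∑ x, π x) / (1 - ε) := by
        rw [mul_sum, ← sum_sub_distrib, sum_div]
        exact sum_congr rfl fun x _ => by ring
      rw [this, hst y, hπ1, mul_one]
      field_simp
    -- `μP = ε·π + (1 − ε)·(μR)`
    have hdec : stepLaw P μ = fun y => ε * π y + (1 - ε) * stepLaw R μ y := by
      funext y
      unfold stepLaw
      simp only [hR]
      have : ∑ x, μ x * ((P x y - ε * π y) / (1 - ε))
          = (∑ x, μ x * P x y - ε * π y * ∑ x, μ x) / (1 - ε) := by
        rw [mul_sum, ← sum_sub_distrib, sum_div]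
        exact sum_congr rfl fun x _ => by ring
      rw [this, hμ1, mul_one]
      field_simp
      ring
    rw [hdec]
    have hconv := klFin_convexComb_le (fun y => (hπ y).le)
      (fun y => stepLaw_nonneg hRrs hμ y) hπ hε0.le hε1
    refine hconv.trans ?_
    rw [klFin_self hπ, mul_zero, zero_add]
    exact mul_le_mul_of_nonneg_left (klFin_stepLaw_le hRrs hπ hRst hμ) h1e.le

/-- **LAZY LAYERS** (row 8: `ε·I + (1 − ε)·Π`): `KL(μP ‖ π) ≤ ε·KL(μ ‖ π)` — entropy contraction
`κ = 1 − ε`, by convexity alone. [ours] -/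
theorem klFin_stepLaw_lazyLayer_le [DecidableEq X] {π : X → ℝ} (hπ : ∀ x, 0 < π x) {ε : ℝ}
    (hε0 : 0 ≤ ε) (hε1 : ε ≤ 1) {μ : X → ℝ} (hμ : ∀ x, 0 ≤ μ x) (hμ1 : ∑ x, μ x = 1) :
    klFin (stepLaw (lazyLayer π ε) μ) π ≤ ε * klFin μ π := by
  have hstep : stepLaw (lazyLayer π ε) μ = fun y => ε * μ y + (1 - ε) * π y :=
    funext fun y => stepLaw_lazyLayer π ε hμ1 y
  rw [hstep]
  have h := klFin_convexComb_le hμ (fun y => (hπ y).le) hπ hε0 hε1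
  rw [klFin_self hπ, mul_zero, add_zero] at h
  exact h

/-- **PERFECT RELAXATION** (`P(x, ·) = π`): `KL(μP ‖ π) = 0` (`κ = 1`). [ours] -/
theorem klFin_stepLaw_perfect {π : X → ℝ} (hπ : ∀ x, 0 < π x) {μ : X → ℝ}
    (hμ1 : ∑ x, μ x = 1) : klFin (stepLaw (fun _ y => π y) μ) π = 0 := by
  have hstep : stepLaw (fun _ y => π y) μ = π := by
    funext y
    unfold stepLaw
    rw [← sum_mul, hμ1, one_mul]
  rw [hstep, klFin_self hπ]

/-! ## §4 The Hoeffding envelope of the equilibrium log-MGF -/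

/-- **HOEFFDING'S LEMMA FOR FINITE LAWS**: `π ≥ 0` a probability law, `|D x − D y| ≤ ΔD` for all
`x, y`; then for every real `t`, `log Σ_y π(y) e^{t(D y − Σ_x π(x) D x)} ≤ t²·ΔD²/8` (Mathlib's
`ProbabilityTheory.hasSubgaussianMGF_of_mem_Icc` on the point-mass measure `lawMeasure π`). -/
theorem log_sum_mul_exp_le_hoeffding [Nonempty X] {π : X → ℝ} (hπ : ∀ x, 0 ≤ π x)
    (hπ1 : ∑ x, π x = 1) (D : X → ℝ) {ΔD : ℝ} (hD : ∀ x y, |D x - D y| ≤ ΔD) (t : ℝ) :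
    Real.log (∑ y, π y * Real.exp (t * (D y - ∑ x, π x * D x))) ≤ t ^ 2 * ΔD ^ 2 / 8 := by
  letI : MeasurableSpace X := ⊤
  haveI : MeasurableSingletonClass X := ⟨fun _ => MeasurableSpace.measurableSet_top⟩
  set μ := lawMeasure π hπ hπ1 with hμ
  -- range of `D`
  obtain ⟨xmin, -, hxmin⟩ := exists_min_image univ D univ_nonempty
  obtain ⟨xmax, -, hxmax⟩ := exists_max_image univ D univ_nonempty
  set a := D xmin with ha
  set b := D xmax with hb
  have hab : b - a ≤ ΔD := by
    have := hD xmax xmin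
    rw [← ha, ← hb] at this
    exact (le_abs_self _).trans this
  have hab0 : 0 ≤ b - a := sub_nonneg.2 (hxmin xmax (mem_univ _))
  have hmem : ∀ᵐ ω ∂μ, D ω ∈ Set.Icc a b :=
    MeasureTheory.ae_of_all _ fun ω => ⟨hxmin ω (mem_univ _), hxmax ω (mem_univ _)⟩
  have hsg := ProbabilityTheory.hasSubgaussianMGF_of_mem_Icc (μ := μ) (X := D)
    measurable_from_top.aemeasurable hmem
  have hmgf := hsg.mgf_le t
  -- the mgf and the mean are finite sums
  have hmean : ∫ ω, D ω ∂μ = ∑ x, π x * D x := integral_lawMeasure π hπ hπ1 D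
  have hmgf_eq : ProbabilityTheory.mgf (fun ω => D ω - ∫ ω', D ω' ∂μ) μ t
      = ∑ y, π y * Real.exp (t * (D y - ∑ x, π x * D x)) := by
    rw [ProbabilityTheory.mgf, integral_lawMeasure π hπ hπ1, hmean]
  rw [hmgf_eq] at hmgf
  have hpos : 0 < ∑ y, π y * Real.exp (t * (D y - ∑ x, π x * D x)) := by
    rw [← hmgf_eq]; exact ProbabilityTheory.mgf_pos (hsg.integrable_exp_mul t)
  have hc : ((((‖b - a‖₊ / 2) ^ 2 : NNReal) : ℝ)) * t ^ 2 / 2 ≤ t ^ 2 * ΔD ^ 2 / 8 := by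
    push_cast
    rw [Real.norm_eq_abs, abs_of_nonneg hab0]
    have h1 : (b - a) ^ 2 ≤ ΔD ^ 2 := pow_le_pow_left₀ hab0 hab 2
    nlinarith [sq_nonneg t]
  calc Real.log (∑ y, π y * Real.exp (t * (D y - ∑ x, π x * D x)))
      ≤ Real.log (Real.exp ((((‖b - a‖₊ / 2) ^ 2 : NNReal) : ℝ) * t ^ 2 / 2)) :=
        Real.log_le_log hpos hmgf
    _ = (((‖b - a‖₊ / 2) ^ 2 : NNReal) : ℝ) * t ^ 2 / 2 := Real.log_exp _
    _ ≤ t ^ 2 * ΔD ^ 2 / 8 := hc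

/-- The same for the Gibbs laws of the linear family: `log Σ_y π_c(y) e^{t(D y − ⟨D⟩_c)} ≤ t²ΔD²/8`. -/
theorem log_sum_gibbs_exp_le_hoeffding [Nonempty X] (S₀ D : X → ℝ) {ΔD : ℝ}
    (hD : ∀ x y, |D x - D y| ≤ ΔD) (c t : ℝ) :
    Real.log (∑ y, gibbsLaw (linAction S₀ D c) y * Real.exp (t * (D y - meanD S₀ D c)))
      ≤ t ^ 2 * ΔD ^ 2 / 8 :=
  log_sum_mul_exp_le_hoeffding (fun x => (gibbsLaw_pos _ x).le) (sum_gibbsLaw _) D hD t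

/-! ## §5 The packaged lag law under Doeblin layers -/

/-- **THE LAG LAW UNDER DOEBLIN LAYERS — NO SUP-NORM FACTOR.**  Finite `X`, linear protocol on the
uniform grid `c_{k+1} − c_k = δ > 0`; every layer `P_k` row-stochastic, stationary for its target
`π_{k+1}` and minorised by it, `P_k(x, y) ≥ ε·π_{k+1}(y)` (`0 < ε < 1`); `|D x − D y| ≤ ΔD`.  Then
`|⟨W⟩ − ΔF − KL_qs| ≤ KL_qs + n·δ²·ΔD²·(1 − ε)/(2ε)` — unit span `nδ = 1`: `ΔD²(1−ε)/(2nε)`. [ours] -/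
theorem abs_layerDissipation_sub_qs_le_doeblin [Nonempty X] (S₀ D : X → ℝ) (c : ℕ → ℝ)
    (P : ℕ → X → X → ℝ) (hP : ∀ k, IsRowStochastic (P k)) {δ : ℝ} (hδ : 0 < δ)
    (hc : ∀ k, c (k + 1) - c k = δ)
    (hst : ∀ k y, ∑ x, gibbsLaw (linAction S₀ D (c (k + 1))) x * P k x y
      = gibbsLaw (linAction S₀ D (c (k + 1))) y)
    {ε : ℝ} (hε0 : 0 < ε) (hε1 : ε < 1)
    (hmin : ∀ k x y, ε * gibbsLaw (linAction S₀ D (c (k + 1))) y ≤ P k x y)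
    {ΔD : ℝ} (hD : ∀ x y, |D x - D y| ≤ ΔD) (n : ℕ) :
    |layerDissipation S₀ D c P n - qsDissipation S₀ D c n|
      ≤ qsDissipation S₀ D c n + n * δ ^ 2 * ΔD ^ 2 * (1 - ε) / (2 * ε) := by
  have hK : ∀ k (μ : X → ℝ), (∀ x, 0 ≤ μ x) → ∑ x, μ x = 1 →
      klFin (stepLaw (P k) μ) (gibbsLaw (linAction S₀ D (c (k + 1))))
        ≤ (1 - ε) * klFin μ (gibbsLaw (linAction S₀ D (c (k + 1)))) :=
    fun k μ hμ hμ1 => klFin_stepLaw_le_of_doeblin (hP k) (gibbsLaw_pos _) (sum_gibbsLaw _) (hst k)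
      hε0 hε1.le (hmin k) hμ hμ1
  have hΛp : ∀ j, j < n → Real.log (∑ y, gibbsLaw (linAction S₀ D (c j)) y
      * Real.exp ((2 * δ * (1 - ε) / ε) * (D y - meanD S₀ D (c j))))
        ≤ (2 * δ * (1 - ε) / ε) ^ 2 * ΔD ^ 2 / 8 :=
    fun j _ => log_sum_gibbs_exp_le_hoeffding S₀ D hD (c j) _
  have hΛm : ∀ j, j < n → Real.log (∑ y, gibbsLaw (linAction S₀ D (c j)) y
      * Real.exp (-(2 * δ * (1 - ε) / ε) * (D y - meanD S₀ D (c j))))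
        ≤ (2 * δ * (1 - ε) / ε) ^ 2 * ΔD ^ 2 / 8 := by
    intro j _
    have := log_sum_gibbs_exp_le_hoeffding S₀ D hD (c j) (-(2 * δ * (1 - ε) / ε))
    rwa [neg_sq] at this
  have key := abs_layerDissipation_sub_qs_le_entropy S₀ D c P hP hδ hc hε0 hε1 hK n hΛp hΛm
  have h1e : (1 - ε) ≠ 0 := (sub_pos.2 hε1).ne'
  refine key.trans (le_of_eq ?_)
  field_simp
  ring

/-- **THE SUB-GAUSSIAN READING** (the envelope as a hypothesis, to be MEASURED in equilibrium): under
the Doeblin layers above (`0 < ε < 1`), if the equilibrium log-MGFs satisfy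
`log Σ_y π_j(y) e^{±λ(D y − ⟨D⟩_{c_j})} ≤ λ²s²/2` at `λ = 2δ(1−ε)/ε` for the levels `j < n`, then
`|⟨W⟩ − ΔF − KL_qs| ≤ KL_qs + 2n·δ²·s²·(1 − ε)/ε` — unit span: `(2τ − 1)·s²/n` with `2τ = (2 − ε)/ε`
the AR(1) integrated autocorrelation time at autocorrelation `1 − ε` (E7 / `Scaling/AR1SwitchingLaw`'s
dictionary `k′ = 2τ_int·σ²` as a certified upper envelope, up to `KL_qs`). [ours] -/
theorem abs_layerDissipation_sub_qs_le_doeblin_subGaussian [Nonempty X] (S₀ D : X → ℝ)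
    (c : ℕ → ℝ) (P : ℕ → X → X → ℝ) (hP : ∀ k, IsRowStochastic (P k)) {δ : ℝ} (hδ : 0 < δ)
    (hc : ∀ k, c (k + 1) - c k = δ)
    (hst : ∀ k y, ∑ x, gibbsLaw (linAction S₀ D (c (k + 1))) x * P k x y
      = gibbsLaw (linAction S₀ D (c (k + 1))) y)
    {ε : ℝ} (hε0 : 0 < ε) (hε1 : ε < 1)
    (hmin : ∀ k x y, ε * gibbsLaw (linAction S₀ D (c (k + 1))) y ≤ P k x y)
    {s : ℝ} (n : ℕ)
    (hΛp : ∀ j, j < n → Real.log (∑ y, gibbsLaw (linAction S₀ D (c j)) y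
        * Real.exp ((2 * δ * (1 - ε) / ε) * (D y - meanD S₀ D (c j))))
          ≤ (2 * δ * (1 - ε) / ε) ^ 2 * s ^ 2 / 2)
    (hΛm : ∀ j, j < n → Real.log (∑ y, gibbsLaw (linAction S₀ D (c j)) y
        * Real.exp (-(2 * δ * (1 - ε) / ε) * (D y - meanD S₀ D (c j))))
          ≤ (2 * δ * (1 - ε) / ε) ^ 2 * s ^ 2 / 2) :
    |layerDissipation S₀ D c P n - qsDissipation S₀ D c n|
      ≤ qsDissipation S₀ D c n + 2 * n * δ ^ 2 * s ^ 2 * (1 - ε) / ε := by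
  have hK : ∀ k (μ : X → ℝ), (∀ x, 0 ≤ μ x) → ∑ x, μ x = 1 →
      klFin (stepLaw (P k) μ) (gibbsLaw (linAction S₀ D (c (k + 1))))
        ≤ (1 - ε) * klFin μ (gibbsLaw (linAction S₀ D (c (k + 1)))) :=
    fun k μ hμ hμ1 => klFin_stepLaw_le_of_doeblin (hP k) (gibbsLaw_pos _) (sum_gibbsLaw _) (hst k)
      hε0 hε1.le (hmin k) hμ hμ1
  have key := abs_layerDissipation_sub_qs_le_entropy S₀ D c P hP hδ hc hε0 hε1 hK n hΛp hΛm
  have h1e : (1 - ε) ≠ 0 := (sub_pos.2 hε1).ne'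
  refine key.trans (le_of_eq ?_)
  field_simp

/-! ## §6 Consistency with the sweep-allocation law -/

/-- Iterates of a row-stochastic layer keep probability laws. -/
theorem iterate_stepLaw_prob {P : X → X → ℝ} (hP : IsRowStochastic P) {μ : X → ℝ}
    (hμ : ∀ x, 0 ≤ μ x) (hμ1 : ∑ x, μ x = 1) :
    ∀ m : ℕ, (∀ x, 0 ≤ (stepLaw P)^[m] μ x) ∧ ∑ x, (stepLaw P)^[m] μ x = 1
  | 0 => ⟨hμ, hμ1⟩
  | m + 1 => by
    obtain ⟨h0, h1⟩ := iterate_stepLaw_prob hP hμ hμ1 m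
    rw [Function.iterate_succ_apply']
    exact ⟨stepLaw_nonneg hP h0, by rw [sum_stepLaw hP, h1]⟩

/-- Entropy contraction composes: `m` applications of a Doeblin-`ε` layer (stationary for `π`)
contract `KL(· ‖ π)` by `(1 − ε)^m` — an `m`-sweep layer has `κ_m = 1 − (1 − ε)^m`. [ours] -/
theorem klFin_iterate_stepLaw_le_of_doeblin {P : X → X → ℝ} (hP : IsRowStochastic P) {π : X → ℝ}
    (hπ : ∀ x, 0 < π x) (hπ1 : ∑ x, π x = 1) (hst : ∀ y, ∑ x, π x * P x y = π y)
    {ε : ℝ} (hε0 : 0 < ε) (hε1 : ε ≤ 1) (hmin : ∀ x y, ε * π y ≤ P x y)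
    {μ : X → ℝ} (hμ : ∀ x, 0 ≤ μ x) (hμ1 : ∑ x, μ x = 1) :
    ∀ m : ℕ, klFin ((stepLaw P)^[m] μ) π ≤ (1 - ε) ^ m * klFin μ π
  | 0 => by simp
  | m + 1 => by
    obtain ⟨hμm, hμm1⟩ := iterate_stepLaw_prob hP hμ hμ1 m
    rw [Function.iterate_succ_apply', pow_succ]
    have h1 := klFin_stepLaw_le_of_doeblin hP hπ hπ1 hst hε0 hε1 hmin hμm hμm1
    have h2 := klFin_iterate_stepLaw_le_of_doeblin hP hπ hπ1 hst hε0 hε1 hmin hμ hμ1 m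
    have h1e : 0 ≤ 1 - ε := by linarith
    calc klFin (stepLaw P ((stepLaw P)^[m] μ)) π ≤ (1 - ε) * klFin ((stepLaw P)^[m] μ) π := h1
      _ ≤ (1 - ε) * ((1 - ε) ^ m * klFin μ π) := mul_le_mul_of_nonneg_left h2 h1e
      _ = (1 - ε) ^ m * (1 - ε) * klFin μ π := by ring

/-- **THE SWEEP-ALLOCATION LAW IS RECOVERED.**  With `m` sweeps per step (`κ_m = 1 − q^m`,
`q = 1 − ε`), `n = T/m` steps of span `1` out of a budget of `T` sweeps, the sub-Gaussian envelope of
`layerDissipation_le_entropy` with `KL_qs ≈ σ²/(2n)` reads `2·σ²m/(2T) + 2n(m/T)²σ²·q^m/(1 − q^m)`, and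
this EQUALS `(σ²/T)·sweepFactor q m` — the factor `m(1+q^m)/(1−q^m)` of `Scaling/SweepAllocationLaw`,
non-decreasing in `m` (`sweepFactor_mono`): under the entropy envelope too, one sweep per step is the
best use of a fixed sweep budget. (Pure algebra; `0 ≤ q < 1`, `m ≥ 1`, `T ≠ 0`, `n = T/m`.) [ours] -/
theorem entropyEnvelope_budget_eq_sweepFactor (σ2 : ℝ) {T q : ℝ} (hT : T ≠ 0) (hq0 : 0 ≤ q)
    (hq1 : q < 1) {m : ℕ} (hm : 1 ≤ m) :
    2 * (σ2 * m / (2 * T)) + 2 * (T / m) * (m / T) ^ 2 * σ2 * q ^ m / (1 - q ^ m)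
      = σ2 / T * sweepFactor q m := by
  have hm0 : (m : ℝ) ≠ 0 := by exact_mod_cast (by omega : m ≠ 0)
  have h0 : 1 - q ^ m ≠ 0 := (sub_pos.2 (pow_lt_one₀ hq0 hq1 (by omega))).ne'
  unfold sweepFactor
  field_simp
  ring

end Summit.Ventures.LatticeQCDFlow.Scaling
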